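import Literature.NumberTheory.Automorphic.Liu2021.SplitPlaceSatakeParametersExplicit
import Literature.NumberTheory.Automorphic.Liu2021.CheckOfChiLocal
import Literature.NumberTheory.Automorphic.Liu2021.Def411IrreducibleOfLemD1AsPrinted
import Literature.NumberTheory.Automorphic.HeckeCharacterLocalComponentSmooth
import HarnessLib

/-!
# [Liu2021, Lemma D.1, split case] at `N = 2` for the GLOBAL automorphic character `χ`: the second Satake parameter is `χ̌_w(ϖ_w)·ν(ϖ_w)⁻¹`

Topic `Literature/NumberTheory/Automorphic/Liu2021`; proof file (theorems only: no definition, no named fact, no instance).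

★ `splitPlace_chiCoinv_isSatakeParameter_explicit` (`SplitPlaceSatakeParametersExplicit`) computes, at a place `v` of `F` split in
`E` (`w ∣ v`, `c • w ≠ w`), the Satake parameters `{ν(ϖ_w), χ′(ϖ_w)ν(ϖ_w)⁻¹}` of the `χ`-coinvariants of `ω_s` under the centre
`U(J₁)(F_v) = E_v¹` for an ABSTRACT local central character `χ` and an abstract `χ′` pinned by `χ′(z_w) = χ(z)` and assumed
unramified.  [Liu2021, proof of Lemma D.1, first paragraph (l. 5241)]: «Note that the first component of `χ̌` is simply `χ`» — for
the GLOBAL automorphic character `χ : Chi F E c` of [Liu2021, Def. 4.11] the local central character at `v` is the tree's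
`UnitaryGroup.localCharOfCenter … χ v` and `χ′` IS the `w`-component of the Hecke character `χ̌ = HeckeCharacter.checkOfChi hcc χ`
(★ `CheckOfChi.forall_localComponent_checkOfChi_det`, `CheckOfChiLocal`).  This file makes the two substitutions:

* `splitPlace_isSatakeParameter_localCharOfCenter_checkOfChi` — same data as the ★ explicit theorem MINUS `(χ, hχu, hχc, χ′, hχ′,
  hχ′u)`, PLUS the global `χ : Chi F E c` and `hunr : χ̌.IsUnramifiedAt w`; conclusion: `{ν(ϖ_w), χ̌_w(ϖ_w)·ν(ϖ_w)⁻¹}` is a Satake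
  parameter of the `χ_v`-coinvariants (`χ_v := localCharOfCenter … χ.1 v`), for every uniformizing element `ϖ_w` of `E_w`
  (the four discharged inputs: ★ `norm_localCharOfCenter` ∘ ★ `norm_chi_apply_eq_one`, ★ `continuous_coe_localCharOfCenter`,
  ★ `forall_localComponent_checkOfChi_det`, ★ `HeckeCharacter.IsUnramifiedAt.localComponent_eq_one_of_valuation_eq_one`);
* `splitPlace_isSatakeParameter_localCharOfCenter_checkOfChi_uniformizer` — the same at the CHOSEN uniformiser
  `ϖ_w := HeckeCharacter.uniformizer E w`, second parameter written `χ̌.valueAtUniformizer w · ν(ϖ_w)⁻¹` — the `b₂`-currency of the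
  d6 line's S4 (R4) («`μ₂ := μᶜχ̌|·|^{−1/2}`», [Liu2021, proof of Thm. D.6 (1), l. 5624]).

The `ν`-slot (`ν = μ_w`, print «`μ = ν ⊠ ν⁻¹`», l. 5241) and the global→local reading of the level-`K` Hecke operators are NOT
touched here (sockets S4b-3 / S4c of cell hodgecm-mathlib's d6 card).  HC_CM is NOT proved by anything here (count-neutral).

## References
* [Liu2021] Y. Liu, *Fourier–Jacobi cycles and arithmetic relative trace formula*, Camb. J. Math. 9 (2021) = arXiv:2102.11518,
  Def. 4.11 (l. 2090); App. D §D.1 (l. 5224); proof of Lemma D.1, first paragraph (l. 5241); proof of Thm. D.6 (1) (l. 5624).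
* [CartierCorvallis1979] P. Cartier, *Representations of 𝔭-adic groups: a survey*, PSPM 33 (1979), part 1, §IV (4.2).
-/

set_option autoImplicit false

noncomputable section

open NumberField IsDedekindDomain Matrix
open _root_.MeasureTheory
open scoped MatrixGroups
open ValuativeRel

namespace Literature.NumberTheory.Automorphic.Liu2021

open Literature.NumberTheory.GaloisRepresentations
open Literature.NumberTheory.Automorphic.UnitaryGroup
open Literature.NumberTheory.Automorphic.Liu2021.Def411WeilCarriers
open Literature.NumberTheory.Automorphic.Liu2021.CheckOfChi
open Literature.NumberTheory.GelbartRogawski1991.UnitaryDualPair.LocalSplitting (iota LocalMp localSchrodinger)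
open Literature.RepresentationTheory (TwistedCoinv.rep)
open Literature.RepresentationTheory.HeisenbergGroup (MpPsi leviOpPi)
open Literature.RepresentationTheory.HeisenbergGroup.SymplecticMatrix (glEquiv)

set_option maxHeartbeats 2000000 in -- as in ★ `SplitPlaceSatakeParametersExplicit`: instantiating the ≈ 40 heavy binders of the explicit model at `N := 2` costs ≈ 1M heartbeats of `isDefEq`; the proof is one `exact`
/-- **[Liu2021, Lemma D.1, split case `E = F × F`] at `N = 2` for the GLOBAL automorphic `χ`: the Satake parameters of the
`χ_v`-coinvariants of `ω_s` at a split place `w ∣ v` are `{ν(ϖ_w), χ̌_w(ϖ_w)·ν(ϖ_w)⁻¹}`** — ★ `splitPlace_chiCoinv_isSatakeParameter_explicit`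
with the local central character `χ := χ_v = localCharOfCenter … χ v` (unitary and continuous because `χ` is, [Liu2021, Def. 4.11]
«whose value is necessarily in `ℂ¹`») and `χ′ := χ̌_w = (checkOfChi hcc χ).localComponent w` (print l. 5241 «the first component
of `χ̌` is simply `χ`», ★ `forall_localComponent_checkOfChi_det`), `χ̌` unramified at `w`.  Remaining hypotheses verbatim those of
the ★ explicit theorem: the section `s`, the mixed model `(Γ, η)`, `η(κ_a) = νK(det a)`, `ν ∘ ι_w = νK`, `ν` unramified, a
uniformizing element `ϖ_w`.
[cite: Liu2021, proof of Lemma D.1, first paragraph (l. 5241); App. D §D.1 (l. 5224); Def. 4.11 (l. 2090)]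
[cite: CartierCorvallis1979, §IV (4.2)] -/
theorem splitPlace_isSatakeParameter_localCharOfCenter_checkOfChi
    (F : Type) [Field F] [NumberField F] (E : Type) [Field E] [NumberField E] [Algebra F E]
    [Algebra.IsQuadraticExtension F E] (c : E ≃ₐ[F] E) (hc1 : c ≠ 1) (hcc : c * c = 1) (δ : E) (hcδ : c δ = -δ)
    (hδ : δ ≠ 0) (d : F) (hd : δ * δ = algebraMap F E d) (T : Matrix (Fin 2) (Fin 2) F) (hT : T.IsSymm) (hTd : IsUnit T.det)
    (J : Matrix (Fin 2) (Fin 2) E) (hJ : J = T.map (algebraMap F E)) (hJh : (J.map c)ᵀ = J)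
    (v : HeightOneSpectrum (𝓞 F)) (w : UnitaryGroup.PlacesOver E v) (hw : c • (w : HeightOneSpectrum (𝓞 E)) ≠ w)
    (hJw : IsUnit (UnitaryGroup.placeForm J (w : HeightOneSpectrum (𝓞 E))))
    [MeasurableSpace (v.adicCompletion F)] [BorelSpace (v.adicCompletion F)]
    (μX : Measure (Fin 2 → v.adicCompletion F)) [μX.IsAddHaarMeasure]
    (s : UnitaryGroup.localPi E c 2 J v →* LocalMp F 2 T v)
    (hs : ∀ g, MpPsi.proj _ (s g) = iota F E c 2 hcδ hδ hd T hT hJ v g)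
    (hsm : Representation.IsSmooth ((MpPsi.toRep (localSchrodinger F 2 T v)).comp s))
    (hsu : Representation.IsL2Isometric μX ((MpPsi.toRep (localSchrodinger F 2 T v)).comp s))
    (J₁ : Matrix (Fin 1) (Fin 1) E) (hJ₁ : J₁ 0 0 ≠ 0)
    [LocallyCompactSpace (standardParabolicGL ((w : HeightOneSpectrum (𝓞 E)).adicCompletion E)
      (Zelevinsky1980.lastBlockLabel 2))]
    (μ' : Measure (v.adicCompletion F)) [μ'.IsAddHaarMeasure]
    (Γ : (SchwartzBruhat (Fin 2 → v.adicCompletion F)) ≃ₗ[ℂ] (SchwartzBruhat (Fin 2 → v.adicCompletion F)))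
    (η : UnitaryGroup.localPi E c 2 J v →* ℂˣ)
    (hΓi : ∀ Φ : (SchwartzBruhat (Fin 2 → v.adicCompletion F)), SchwartzBruhat.l2NormSq (Measure.pi fun _ : Fin 2 => μ') (Γ Φ) =
      SchwartzBruhat.l2NormSq (Measure.pi fun _ : Fin 2 => μ') Φ)
    (hmodel : ∀ (a : GL (Fin 2) (v.adicCompletion F)) (Φ : (SchwartzBruhat (Fin 2 → v.adicCompletion F))),
      (MpPsi.toRep (localSchrodinger F 2 T v)).comp s
          ((UnitaryGroup.localPiSplitEquiv c J hc1 hJh w hw hJw).symm (Matrix.GeneralLinearGroup.map (toPlace v w) a)) Φ =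
        ((η ((UnitaryGroup.localPiSplitEquiv c J hc1 hJh w hw hJw).symm (Matrix.GeneralLinearGroup.map (toPlace v w) a)) : ℂˣ) :
            ℂ) • Γ.symm (leviOpPi (glEquiv (GLn.contragredient a)) (Γ Φ)))
    (νK : (v.adicCompletion F)ˣ →* ℂˣ)
    (hη : ∀ a : GL (Fin 2) (v.adicCompletion F),
      η ((UnitaryGroup.localPiSplitEquiv c J hc1 hJh w hw hJw).symm (Matrix.GeneralLinearGroup.map (toPlace v w) a)) =
        νK (Matrix.GeneralLinearGroup.det a))
    (ν : ((w : HeightOneSpectrum (𝓞 E)).adicCompletion E)ˣ →* ℂˣ)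
    (hν : ∀ t : (v.adicCompletion F)ˣ,
      ν (Units.map (toPlace v w : v.adicCompletion F →+* (w : HeightOneSpectrum (𝓞 E)).adicCompletion E).toMonoidHom t) = νK t)
    (hνu : ∀ u : ((w : HeightOneSpectrum (𝓞 E)).adicCompletion E)ˣ,
      valuation ((w : HeightOneSpectrum (𝓞 E)).adicCompletion E) (u : (w : HeightOneSpectrum (𝓞 E)).adicCompletion E) = 1 →
        ν u = 1)
    -- NEW: the GLOBAL automorphic character and the unramifiedness of `χ̌` at `w`
    (χ : Chi F E c) (hunr : (HeckeCharacter.checkOfChi hcc χ).IsUnramifiedAt (w : HeightOneSpectrum (𝓞 E)))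
    {ϖ : (w : HeightOneSpectrum (𝓞 E)).adicCompletion E} (hϖ : IsUniformizingElement ϖ) :
    IsSatakeParameter
      ((TwistedCoinv.rep
        (ρW := show Representation ℂ (UnitaryGroup.localPi E c 1 J₁ v) (SchwartzBruhat (Fin 2 → v.adicCompletion F)) from
          ((MpPsi.toRep (localSchrodinger F 2 T v)).comp s).comp (UnitaryGroup.localCenter E c 2 J J₁ hJ₁ v))
        (localCharOfCenter F E c J₁ hJ₁ (χ : finAdelicOne F E c →* ℂˣ) v) ((MpPsi.toRep (localSchrodinger F 2 T v)).comp s)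
        (fun g z => (show Commute g (UnitaryGroup.localCenter E c 2 J J₁ hJ₁ v z) from
          UnitaryGroup.localCenter_comm E c 2 J J₁ hJ₁ v z g).map ((MpPsi.toRep (localSchrodinger F 2 T v)).comp s))).comp
        (UnitaryGroup.localPiSplitEquiv c J hc1 hJh w hw hJw).symm.toMonoidHom)
      (Units.mk0 ϖ hϖ.ne_zero)
      {((ν (Units.mk0 ϖ hϖ.ne_zero) : ℂˣ) : ℂ),
        (((HeckeCharacter.checkOfChi hcc χ).localComponent (w : HeightOneSpectrum (𝓞 E)) (Units.mk0 ϖ hϖ.ne_zero) : ℂˣ) : ℂ) *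
          (((ν (Units.mk0 ϖ hϖ.ne_zero) : ℂˣ) : ℂ))⁻¹} :=
  splitPlace_chiCoinv_isSatakeParameter_explicit F E c hc1 δ hcδ hδ d hd T hT hTd J hJ hJh v w hw hJw μX s hs hsm hsu J₁ hJ₁
    μ' Γ η hΓi hmodel νK hη ν hν (localCharOfCenter F E c J₁ hJ₁ (χ : finAdelicOne F E c →* ℂˣ) v)
    (norm_localCharOfCenter F E c J₁ hJ₁
      (norm_chi_apply_eq_one F E c (Algebra.IsQuadraticExtension.finrank_eq_two F E) hc1 χ) v)
    (continuous_coe_localCharOfCenter F E c J₁ hJ₁ χ.2.1 v)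
    ((HeckeCharacter.checkOfChi hcc χ).localComponent (w : HeightOneSpectrum (𝓞 E)))
    (forall_localComponent_checkOfChi_det hcc hJ₁ χ w hw) hνu
    (fun _ hu => hunr.localComponent_eq_one_of_valuation_eq_one hu) hϖ

set_option maxHeartbeats 2000000 in -- same instantiation cost as the previous theorem (≈ 40 heavy binders at `N := 2`)
/-- **The same at the CHOSEN uniformiser `ϖ_w := HeckeCharacter.uniformizer E w`, second parameter in `valueAtUniformizer`
currency: `{ν(ϖ_w), χ̌(ϖ_w)·ν(ϖ_w)⁻¹}` with `χ̌(ϖ_w) = (checkOfChi hcc χ).valueAtUniformizer w`** — the `b₂`-reading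
«`μ₂ := μᶜ χ̌ |·|_E^{−1/2}`» of [Liu2021, proof of Thm. D.6 (1), l. 5624] at a split place, modulo the `ν`-slot (`ν = μ_w`).
(`ϖ_w` is a uniformizing element by ★ `isUniformizingElement_of_valued_eq` ∘ ★ `HeckeCharacter.valued_uniformizer`.)
[cite: Liu2021, proof of Lemma D.1, first paragraph (l. 5241); Thm. D.6 (1) proof (l. 5624)]
[cite: CartierCorvallis1979, §IV (4.2)] -/
theorem splitPlace_isSatakeParameter_localCharOfCenter_checkOfChi_uniformizer
    (F : Type) [Field F] [NumberField F] (E : Type) [Field E] [NumberField E] [Algebra F E]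
    [Algebra.IsQuadraticExtension F E] (c : E ≃ₐ[F] E) (hc1 : c ≠ 1) (hcc : c * c = 1) (δ : E) (hcδ : c δ = -δ)
    (hδ : δ ≠ 0) (d : F) (hd : δ * δ = algebraMap F E d) (T : Matrix (Fin 2) (Fin 2) F) (hT : T.IsSymm) (hTd : IsUnit T.det)
    (J : Matrix (Fin 2) (Fin 2) E) (hJ : J = T.map (algebraMap F E)) (hJh : (J.map c)ᵀ = J)
    (v : HeightOneSpectrum (𝓞 F)) (w : UnitaryGroup.PlacesOver E v) (hw : c • (w : HeightOneSpectrum (𝓞 E)) ≠ w)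
    (hJw : IsUnit (UnitaryGroup.placeForm J (w : HeightOneSpectrum (𝓞 E))))
    [MeasurableSpace (v.adicCompletion F)] [BorelSpace (v.adicCompletion F)]
    (μX : Measure (Fin 2 → v.adicCompletion F)) [μX.IsAddHaarMeasure]
    (s : UnitaryGroup.localPi E c 2 J v →* LocalMp F 2 T v)
    (hs : ∀ g, MpPsi.proj _ (s g) = iota F E c 2 hcδ hδ hd T hT hJ v g)
    (hsm : Representation.IsSmooth ((MpPsi.toRep (localSchrodinger F 2 T v)).comp s))
    (hsu : Representation.IsL2Isometric μX ((MpPsi.toRep (localSchrodinger F 2 T v)).comp s))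
    (J₁ : Matrix (Fin 1) (Fin 1) E) (hJ₁ : J₁ 0 0 ≠ 0)
    [LocallyCompactSpace (standardParabolicGL ((w : HeightOneSpectrum (𝓞 E)).adicCompletion E)
      (Zelevinsky1980.lastBlockLabel 2))]
    (μ' : Measure (v.adicCompletion F)) [μ'.IsAddHaarMeasure]
    (Γ : (SchwartzBruhat (Fin 2 → v.adicCompletion F)) ≃ₗ[ℂ] (SchwartzBruhat (Fin 2 → v.adicCompletion F)))
    (η : UnitaryGroup.localPi E c 2 J v →* ℂˣ)
    (hΓi : ∀ Φ : (SchwartzBruhat (Fin 2 → v.adicCompletion F)), SchwartzBruhat.l2NormSq (Measure.pi fun _ : Fin 2 => μ') (Γ Φ) =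
      SchwartzBruhat.l2NormSq (Measure.pi fun _ : Fin 2 => μ') Φ)
    (hmodel : ∀ (a : GL (Fin 2) (v.adicCompletion F)) (Φ : (SchwartzBruhat (Fin 2 → v.adicCompletion F))),
      (MpPsi.toRep (localSchrodinger F 2 T v)).comp s
          ((UnitaryGroup.localPiSplitEquiv c J hc1 hJh w hw hJw).symm (Matrix.GeneralLinearGroup.map (toPlace v w) a)) Φ =
        ((η ((UnitaryGroup.localPiSplitEquiv c J hc1 hJh w hw hJw).symm (Matrix.GeneralLinearGroup.map (toPlace v w) a)) : ℂˣ) :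
            ℂ) • Γ.symm (leviOpPi (glEquiv (GLn.contragredient a)) (Γ Φ)))
    (νK : (v.adicCompletion F)ˣ →* ℂˣ)
    (hη : ∀ a : GL (Fin 2) (v.adicCompletion F),
      η ((UnitaryGroup.localPiSplitEquiv c J hc1 hJh w hw hJw).symm (Matrix.GeneralLinearGroup.map (toPlace v w) a)) =
        νK (Matrix.GeneralLinearGroup.det a))
    (ν : ((w : HeightOneSpectrum (𝓞 E)).adicCompletion E)ˣ →* ℂˣ)
    (hν : ∀ t : (v.adicCompletion F)ˣ,
      ν (Units.map (toPlace v w : v.adicCompletion F →+* (w : HeightOneSpectrum (𝓞 E)).adicCompletion E).toMonoidHom t) = νK t)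
    (hνu : ∀ u : ((w : HeightOneSpectrum (𝓞 E)).adicCompletion E)ˣ,
      valuation ((w : HeightOneSpectrum (𝓞 E)).adicCompletion E) (u : (w : HeightOneSpectrum (𝓞 E)).adicCompletion E) = 1 →
        ν u = 1)
    (χ : Chi F E c) (hunr : (HeckeCharacter.checkOfChi hcc χ).IsUnramifiedAt (w : HeightOneSpectrum (𝓞 E))) :
    IsSatakeParameter
      ((TwistedCoinv.rep
        (ρW := show Representation ℂ (UnitaryGroup.localPi E c 1 J₁ v) (SchwartzBruhat (Fin 2 → v.adicCompletion F)) from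
          ((MpPsi.toRep (localSchrodinger F 2 T v)).comp s).comp (UnitaryGroup.localCenter E c 2 J J₁ hJ₁ v))
        (localCharOfCenter F E c J₁ hJ₁ (χ : finAdelicOne F E c →* ℂˣ) v) ((MpPsi.toRep (localSchrodinger F 2 T v)).comp s)
        (fun g z => (show Commute g (UnitaryGroup.localCenter E c 2 J J₁ hJ₁ v z) from
          UnitaryGroup.localCenter_comm E c 2 J J₁ hJ₁ v z g).map ((MpPsi.toRep (localSchrodinger F 2 T v)).comp s))).comp
        (UnitaryGroup.localPiSplitEquiv c J hc1 hJh w hw hJw).symm.toMonoidHom)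
      (HeckeCharacter.uniformizer E (w : HeightOneSpectrum (𝓞 E)))
      {((ν (HeckeCharacter.uniformizer E (w : HeightOneSpectrum (𝓞 E))) : ℂˣ) : ℂ),
        (HeckeCharacter.checkOfChi hcc χ).valueAtUniformizer (w : HeightOneSpectrum (𝓞 E)) *
          (((ν (HeckeCharacter.uniformizer E (w : HeightOneSpectrum (𝓞 E))) : ℂˣ) : ℂ))⁻¹} := by
  have hϖ : IsUniformizingElement
      ((HeckeCharacter.uniformizer E (w : HeightOneSpectrum (𝓞 E)) : ((w : HeightOneSpectrum (𝓞 E)).adicCompletion E)ˣ) :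
        (w : HeightOneSpectrum (𝓞 E)).adicCompletion E) :=
    isUniformizingElement_of_valued_eq E (w : HeightOneSpectrum (𝓞 E)) (HeckeCharacter.valued_uniformizer _)
  have h := splitPlace_isSatakeParameter_localCharOfCenter_checkOfChi F E c hc1 hcc δ hcδ hδ d hd T hT hTd J hJ hJh v w hw hJw
    μX s hs hsm hsu J₁ hJ₁ μ' Γ η hΓi hmodel νK hη ν hν hνu χ hunr hϖ
  rw [Units.mk0_val] at h
  exact h

end Literature.NumberTheory.Automorphic.Liu2021

end
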